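import Summits.Ventures.Crystal3D.Theorems.StickyWulffConstantCoaxialWallLawKFoldTopStars
import Summits.Ventures.Crystal3D.Theorems.StickyWulffConstantCoaxialWallLawSharpTwin
import HarnessLib

/-!
# `KFoldTopDeficit` = `StarPairCoaxial` + its GLIDE rows; the sharp twin law on these two inputs

HONEST FRAMING. Part of the venture `Summits/Ventures/Crystal3D` (cell `crystal3d-full`), route
`route-Ventures-StickyWulffConstant`, crux `CoaxialWallLaw` (stmt-Ventures-19481), REGISTERED line `WallLedgerF`, open
stub `stub_coaxialTwoSlabAdhesion`.  Rung credit only; F-C1 not moved.  DEFINITIONS + glue: the k-fold-top census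
target `KFoldTopDeficit` (`…KFoldTop`; the one local input of the sharp twin law `…SharpTwin`) SPLITS into
  (a) families WITHOUT a glide-type arrival — settled by the stars-only input `StarPairCoaxial` of the 19480 lane
      (`kFoldTop_noGlide_of_starPairCoaxial`, `…KFoldTopStars`; computational halves certified, R39d/R41e family), and
  (b) families WITH at least one GLIDE-type arrival (a predecessor read as a twin dozen of `(A, n)` with the arrival
      slot IN the composition plane, `⟪A u, n⟫ = 0`; its arrival star is the equatorial `A12` star, SLOTEX A12-583) —
      the census target `KFoldTopGlide` DEFINED here (posited, NOT proved; lit g13's rows (C,G), (G,G), kit j298595).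

* `KFoldTopGlide` — `KFoldTopDeficit`'s statement restricted to families containing a glide-type arrival.
* **`kFoldTopDeficit_of_starPair_of_glide`** — `StarPairCoaxial → KFoldTopGlide → KFoldTopDeficit`.
* **`coaxialTwoSlabAdhesion_general_twin_of_starPair`** — the stub's inequality with `½` for every twin pair,
  arbitrary fillings, conditional on {E1 rows C12-55 / A12-583, `StarPairCoaxial`, `KFoldTopGlide`, `KissingGap δ`}.

WHAT THIS IS NOT: a proof of `KFoldTopGlide` or `StarPairCoaxial`; not the stub; F-C1 not moved.
-/

noncomputable section

namespace Summit.Ventures.Crystal3D.Theorems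

open Summit.Ventures.Crystal3D Finset
open Literature.MathematicalPhysics.StatisticalMechanics (fccStacking barlowStacking IsHaggSeq contactDeficiency)
open scoped InnerProductSpace

open scoped Classical in
/-- **The GLIDE rows of the k-fold-top census** (posited; NOT proved): `KFoldTopDeficit`'s statement for families
of arrival data containing at least one glide-type arrival (a twin-reading predecessor with the arrival slot in the
composition plane).  See the module docstring. -/
def KFoldTopGlide : Prop :=
  ∀ (X : Finset (EuclideanSpace ℝ (Fin 3))), (∀ p ∈ X, ∀ q ∈ X, p ≠ q → 1 ≤ dist p q) →
    ∀ b ∈ X, ∀ S : Finset ((EuclideanSpace ℝ (Fin 3) ≃ₗᵢ[ℝ] EuclideanSpace ℝ (Fin 3)) × EuclideanSpace ℝ (Fin 3)),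
      2 ≤ S.card →
      (∀ s ∈ S, s.2 ∈ fccSlots ∧ b - s.1 s.2 ∈ X) →
      (∀ s ∈ S, (∀ w ∈ fccSlots, b - s.1 s.2 + s.1 w ∈ X) ∨
        ∃ n : EuclideanSpace ℝ (Fin 3), ‖n‖ = 1 ∧
          (∀ w ∈ fccSlots, ⟪s.1 w, n⟫_ℝ = 0 ∨ ⟪s.1 w, n⟫_ℝ = Real.sqrt (2 / 3) ∨ ⟪s.1 w, n⟫_ℝ = -Real.sqrt (2 / 3)) ∧
          (∀ w ∈ fccSlots, ⟪s.1 w, n⟫_ℝ ≤ 0 → b - s.1 s.2 + s.1 w ∈ X) ∧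
          (∀ w ∈ fccSlots, ⟪s.1 w, n⟫_ℝ < 0 → b - s.1 s.2 + (s.1 w - (2 * ⟪s.1 w, n⟫_ℝ) • n) ∈ X) ∧
          (∀ w ∈ fccSlots, 0 < ⟪s.1 w, n⟫_ℝ → b - s.1 s.2 + s.1 w ∉ X)) →
      -- at least one GLIDE-type arrival
      (∃ s ∈ S, ∃ n : EuclideanSpace ℝ (Fin 3), ‖n‖ = 1 ∧
          (∀ w ∈ fccSlots, ⟪s.1 w, n⟫_ℝ = 0 ∨ ⟪s.1 w, n⟫_ℝ = Real.sqrt (2 / 3) ∨ ⟪s.1 w, n⟫_ℝ = -Real.sqrt (2 / 3)) ∧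
          (∀ w ∈ fccSlots, ⟪s.1 w, n⟫_ℝ ≤ 0 → b - s.1 s.2 + s.1 w ∈ X) ∧
          (∀ w ∈ fccSlots, ⟪s.1 w, n⟫_ℝ < 0 → b - s.1 s.2 + (s.1 w - (2 * ⟪s.1 w, n⟫_ℝ) • n) ∈ X) ∧
          (∀ w ∈ fccSlots, 0 < ⟪s.1 w, n⟫_ℝ → b - s.1 s.2 + s.1 w ∉ X) ∧
          ⟪s.1 s.2, n⟫_ℝ = 0) →
      (∀ s ∈ S, ∀ t ∈ S, s ≠ t → b - s.1 s.2 ≠ b - t.1 t.2) →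
      (∀ s ∈ S, ∀ t ∈ S, s ≠ t →
        (t.1 : EuclideanSpace ℝ (Fin 3) → EuclideanSpace ℝ (Fin 3)) '' ↑fccSlots ≠
          (s.1 : EuclideanSpace ℝ (Fin 3) → EuclideanSpace ℝ (Fin 3)) '' ↑fccSlots ∧
        ∀ n : EuclideanSpace ℝ (Fin 3), ‖n‖ = 1 →
          (∀ w ∈ fccSlots, ⟪s.1 w, n⟫_ℝ = 0 ∨ ⟪s.1 w, n⟫_ℝ = Real.sqrt (2 / 3) ∨ ⟪s.1 w, n⟫_ℝ = -Real.sqrt (2 / 3)) →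
          (t.1 : EuclideanSpace ℝ (Fin 3) → EuclideanSpace ℝ (Fin 3)) '' ↑fccSlots ≠
            (fun x => s.1 x - (2 * ⟪s.1 x, n⟫_ℝ) • n) '' ↑fccSlots) →
      (X.filter fun q => dist b q = 1).card + S.card ≤ 12

/-- **`KFoldTopDeficit` from the stars-only input and the glide rows.**  See the module docstring. -/
theorem kFoldTopDeficit_of_starPair_of_glide (hSP : StarPairCoaxial) (hG : KFoldTopGlide) : KFoldTopDeficit := by
  intro X hX b hb S h2 hS hread hdist hnc
  have hr : 0 < Real.sqrt (2 / 3) := Real.sqrt_pos.2 (by norm_num)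
  by_cases hglide : ∃ s ∈ S, ∃ n : EuclideanSpace ℝ (Fin 3), ‖n‖ = 1 ∧
      (∀ w ∈ fccSlots, ⟪s.1 w, n⟫_ℝ = 0 ∨ ⟪s.1 w, n⟫_ℝ = Real.sqrt (2 / 3) ∨ ⟪s.1 w, n⟫_ℝ = -Real.sqrt (2 / 3)) ∧
      (∀ w ∈ fccSlots, ⟪s.1 w, n⟫_ℝ ≤ 0 → b - s.1 s.2 + s.1 w ∈ X) ∧
      (∀ w ∈ fccSlots, ⟪s.1 w, n⟫_ℝ < 0 → b - s.1 s.2 + (s.1 w - (2 * ⟪s.1 w, n⟫_ℝ) • n) ∈ X) ∧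
      (∀ w ∈ fccSlots, 0 < ⟪s.1 w, n⟫_ℝ → b - s.1 s.2 + s.1 w ∉ X) ∧
      ⟪s.1 s.2, n⟫_ℝ = 0
  · exact hG X hX b hb S h2 hS hread hglide hdist hnc
  · -- no glide arrival: every twin reading has the arrival slot on the negative side
    push Not at hglide
    refine kFoldTop_noGlide_of_starPairCoaxial hSP X hX b hb S h2 hS (fun s hs => ?_) hnc
    rcases hread s hs with hfull | ⟨n, hn, hmenu, hown, hmir, hfar⟩
    · exact Or.inl hfull
    · right
      refine ⟨n, hn, hmenu, hown, ?_⟩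
      obtain ⟨hu, hp⟩ := hS s hs
      rcases hmenu s.2 hu with h0 | hpos | hneg
      · exact absurd h0 (hglide s hs n hn hmenu hown hmir hfar)
      · -- a far arrival slot: `b = (b − A u) + A u ∉ X`, absurd
        exfalso
        have := hfar s.2 hu (by rw [hpos]; exact hr)
        rw [sub_add_cancel] at this
        exact this hb
      · rw [hneg]; linarith

/-- **The stub's inequality with `½` for every twin pair, on the split census inputs** (`StarPairCoaxial` +
`KFoldTopGlide` in place of `KFoldTopDeficit`). -/
theorem coaxialTwoSlabAdhesion_general_twin_of_starPair {δ : ℝ} (hg : KissingGap δ) (hδ0 : 0 < δ)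
    (hδ : 16 / 3 < δ ^ 2) (hSP : StarPairCoaxial) (hG : KFoldTopGlide)
    {s₀ : EuclideanSpace ℝ (Fin 3)} (hs₀ : s₀ ∈ fccSlots)
    (hcert : ExactOnly 0 (fccSlots.filter fun w => 0 < ⟪w, s₀⟫_ℝ))
    (hcertA : ∀ (A : EuclideanSpace ℝ (Fin 3) ≃ₗᵢ[ℝ] EuclideanSpace ℝ (Fin 3)) (n : EuclideanSpace ℝ (Fin 3)),
      ‖n‖ = 1 → (∀ w ∈ fccSlots, ⟪A w, n⟫_ℝ = 0 ∨ ⟪A w, n⟫_ℝ = Real.sqrt (2 / 3) ∨ ⟪A w, n⟫_ℝ = -Real.sqrt (2 / 3)) →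
      ∀ u ∈ fccSlots, ⟪A u, n⟫_ℝ = 0 → ∀ b : EuclideanSpace ℝ (Fin 3),
      ExactOnly b (insert (b - A u)
        (((fccSlots.filter fun s => ⟪s, u⟫_ℝ = -(1 / 2) ∧ ⟪A (u + s), n⟫_ℝ ≤ 0).image (fun s => b + A s)) ∪
          ((fccSlots.filter fun s => ⟪s, u⟫_ℝ = -(1 / 2) ∧ ⟪A (u + s), n⟫_ℝ < 0).image
            (fun s => b + (A s - (2 * ⟪A s, n⟫_ℝ) • n))))))
    (A₁ : EuclideanSpace ℝ (Fin 3) ≃ₗᵢ[ℝ] EuclideanSpace ℝ (Fin 3)) (t₁ : EuclideanSpace ℝ (Fin 3))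
    (A₂ : EuclideanSpace ℝ (Fin 3) ≃ₗᵢ[ℝ] EuclideanSpace ℝ (Fin 3)) (t₂ : EuclideanSpace ℝ (Fin 3))
    (L : EuclideanSpace ℝ (Fin 3) ≃ₗᵢ[ℝ] EuclideanSpace ℝ (Fin 3)) (s₁ s₂ : EuclideanSpace ℝ (Fin 3))
    (σ σ' : ℤ → ℤ) (hσ : IsHaggSeq σ) (hσ' : IsHaggSeq σ')
    (hsub₁ : (fun p => A₁ p + t₁) '' fccStacking 1 (Real.sqrt (2 / 3)) ⊆
      (fun p => L p + s₁) '' barlowStacking 1 (Real.sqrt (2 / 3)) σ)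
    (hsub₂ : (fun p => A₂ p + t₂) '' fccStacking 1 (Real.sqrt (2 / 3)) ⊆
      (fun p => L p + s₂) '' barlowStacking 1 (Real.sqrt (2 / 3)) σ')
    (htwin : A₁ '' fccStacking 1 (Real.sqrt (2 / 3)) ≠ A₂ '' fccStacking 1 (Real.sqrt (2 / 3))) :
    ∃ C R₀ : ℝ, 1 ≤ R₀ ∧ ∀ h : ℝ, 0 ≤ h → ∀ ρ : ℝ, R₀ ≤ ρ →
      ∀ X P₁ P₂ : Finset (EuclideanSpace ℝ (Fin 3)),
      (∀ p ∈ X, ∀ q ∈ X, p ≠ q → 1 ≤ dist p q) → P₁ ⊆ X → P₂ ⊆ X \ P₁ →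
      (∀ p ∈ X, -(2 * R₀) ≤ p 2 ∧ p 2 ≤ h + 2 * R₀ ∧ p 0 ^ 2 + p 1 ^ 2 ≤ ρ ^ 2) →
      (∀ p, p ∈ P₁ ↔ (p ∈ (fun q => A₁ q + t₁) '' fccStacking 1 (Real.sqrt (2 / 3)) ∧
        -(2 * R₀) ≤ p 2 ∧ p 2 ≤ -R₀ ∧ p 0 ^ 2 + p 1 ^ 2 ≤ ρ ^ 2)) →
      (∀ p, p ∈ P₂ ↔ (p ∈ (fun q => A₂ q + t₂) '' fccStacking 1 (Real.sqrt (2 / 3)) ∧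
        h + R₀ ≤ p 2 ∧ p 2 ≤ h + 2 * R₀ ∧ p 0 ^ 2 + p 1 ^ 2 ≤ ρ ^ 2)) →
      ((((P₁ ×ˢ (X \ P₁)).filter fun pq => dist pq.1 pq.2 = 1).card : ℕ) : ℝ) +
        ((((P₂ ×ˢ ((X \ P₁) \ P₂)).filter fun pq => dist pq.1 pq.2 = 1).card : ℕ) : ℝ) ≤
        contactDeficiency ((X \ P₁) \ P₂) +
          (Real.sqrt 2 / 4 * ∑ᶠ w ∈ {w ∈ fccStacking 1 (Real.sqrt (2 / 3)) | ‖w‖ = 1},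
              |⟪w, A₁.symm (EuclideanSpace.single (2 : Fin 3) (1 : ℝ))⟫_ℝ| +
            Real.sqrt 2 / 4 * ∑ᶠ w ∈ {w ∈ fccStacking 1 (Real.sqrt (2 / 3)) | ‖w‖ = 1},
              |⟪w, A₂.symm (EuclideanSpace.single (2 : Fin 3) (1 : ℝ))⟫_ℝ| -
            (1 / 2 : ℝ) * Real.sqrt (1 - ⟪L (EuclideanSpace.single (2 : Fin 3) (1 : ℝ)),
              (EuclideanSpace.single (2 : Fin 3) (1 : ℝ))⟫_ℝ ^ 2)) * Real.pi * ρ ^ 2 +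
          C * (1 + h) * ρ :=
  coaxialTwoSlabAdhesion_general_twin_of_census hg hδ0 hδ (kFoldTopDeficit_of_starPair_of_glide hSP hG) hs₀ hcert
    hcertA A₁ t₁ A₂ t₂ L s₁ s₂ σ σ' hσ hσ' hsub₁ hsub₂ htwin

end Summit.Ventures.Crystal3D.Theorems

end
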